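import Mathlib
import HarnessLib
import Summits.Ventures.LatticeQCDFlow.Scaling.TorusRankedThreeDimCount

/-!
# LatticeQCDFlow / Scaling — the homology bound for ranked plaquette structures of `(ℤ/L)^d`:
# `#B + #sites + d ≤ #links + 1`, so at least `(d−1)(d−2)/2·L^d + (d−1)` plaquettes stay outside —
# and in three dimensions the optimum is EXACTLY `L³ + 2`

HONEST FRAMING: exact (Metropolis-corrected) sampling algorithms for lattice gauge theory;
figures of merit are autocorrelation/cost numbers at stated couplings and volumes; no
continuum-physics claim.

Venture `LatticeQCDFlow` (cell pub-lqcd), topic `Scaling`, FANOUT row 30 (lean-1, GEN-25) — OUR WORK on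
THEORY-2.md §4 row C5.  A collection `B` of plaquettes of `(ℤ/L)^d` RANKED for a top-link assignment `t`
(`t p` a link of `p`; `rank p < rank p'` whenever `t p` lies on another `p' ∈ B`) carries an exact
one-plaquette heat-bath autoregression (`Scaling/AutoregressiveGaugeHeatBathRanked`); the `k = #Bᶜ`
plaquettes outside are paid for by the Metropolis step (`…AnyDim`, `…Scorecard`, `…KL`).
`TorusRankedParityBound` proved `#B + #sites ≤ #links + 1` (the boundary vectors of `B` are independent
in the kernel of the vertex-parity map `∂₁`, whose rank is `≥ #sites − 1`).  Here the `d` independent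
one-cycles of the torus are added to the count — the first homology of `(ℤ/L)^d` over `ℤ/2`:

* §1 the WINDING FUNCTIONALS `f ↦ (m ↦ Σ_{x : x_m = 0} f(x, m))` (the number, mod 2, of direction-`m`
  links of `f` leaving the hyperplane `{x_m = 0}`) are linear (`winding_isLinear`), take a single link
  `𝟙_{(x,i)}` to `[x_i = 0]·𝟙_i` (`winding_single`) and KILL EVERY BOUNDARY VECTOR
  (**`winding_boundaryVec`**: the two direction-`i` links of a plaquette `(x; i, j)` have the same `i`-th
  coordinate);
* §2 the STRAIGHT LINES `z_n = Σ_{c ∈ ℤ/L} 𝟙_{(c·e_n, n)}` are cycles (**`vertexParity_line`**: the line is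
  invariant under the shift by `e_n`) with winding vector `𝟙_n` (**`winding_line`**);
* §3 **`card_add_card_site_add_le_card_edge_add_one_of_ranked`** — `#B + #sites + d ≤ #links + 1` for
  every ranked `B` (`L ≥ 2`): the boundary vectors of `B` are independent in the kernel of
  `ψ = (∂₁, winding)`, whose range contains the `#sites − 1 + d` independent vectors
  `(𝟙_0 + 𝟙_y, ·)` (`y ≠ 0`, lattice paths) and `(0, 𝟙_n)` (the lines); rank–nullity.  Hence
  **`card_plaquette_add_card_site_add_le_of_ranked`** (`#plaquettes + #sites + d ≤ k + #links + 1`) and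
  the closed form **`homologyBound_closed_form`**: `(d−1)(d−2)·L^d + 2(d−1) ≤ 2k`;
* §4 instances: `d = 3`: **`pow_three_add_two_le_card_compl_of_ranked`** (`L³ + 2 ≤ k`) — met EXACTLY by
  the comb-tree structure of `TorusRankedThreeDimCount` (`k = L³ + 2`), so
  **`threeDim_gap_eq`** / **`isLeast_card_compl_ranked_three`**: the minimum number of plaquettes of
  `(ℤ/L)³` outside a ranked structure is EXACTLY `L³ + 2` (GEN-24 left `L³ − 1 ≤ k_min ≤ L³ + 2`);
  `d = 4`: **`three_mul_pow_four_add_three_le_card_compl_of_ranked`** (`3L⁴ + 3 ≤ k`, against the layers'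
  `3L⁴ + 3L³`); `d = 2`: `1 ≤ k` again (the comb).

No `def` (the functionals, lines and maps are spelled out as terms), no `sorry`, nothing cited as a fact
beyond the tree.
-/

namespace Summit.Ventures.LatticeQCDFlow.Theory2.Autoregressive

open Finset
open Literature.MathematicalPhysics.QuantumFieldTheory

variable {d L : ℕ} [NeZero L]

/-! ## §1 The winding functionals kill every boundary vector -/

/-- The winding map `f ↦ (m ↦ Σ_{x : x_m = 0} f(x, m))` is `ℤ/2`-linear. [ours] -/
theorem winding_isLinear :
    IsLinearMap (ZMod 2) (fun f : Edge d L → ZMod 2 =>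
      fun m : Fin d => ∑ x ∈ (Finset.univ.filter fun x : Site d L => x m = 0), f (x, m)) := by
  constructor
  · intro f g; ext m
    simp only [Pi.add_apply, Finset.sum_add_distrib]
  · intro c f; ext m
    simp only [Pi.smul_apply, smul_eq_mul, Finset.mul_sum]

/-- The winding vector of a single link `𝟙_{(x,i)}`: component `m` is `1` iff `m = i` and `x_i = 0`. [ours] -/
theorem winding_single (x : Site d L) (i m : Fin d) :
    ∑ y ∈ (Finset.univ.filter fun y : Site d L => y m = 0),
        (Pi.single (x, i) 1 : Edge d L → ZMod 2) (y, m) = if m = i ∧ x i = 0 then 1 else 0 := by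
  classical
  by_cases hm : m = i
  · rw [hm, if_congr (and_iff_right rfl) rfl rfl]
    by_cases hx : x i = 0
    · rw [if_pos hx, Finset.sum_eq_single x]
      · simp
      · intro y _ hy
        have : ((y, i) : Edge d L) ≠ (x, i) := fun h => hy (congrArg Prod.fst h)
        simp [this]
      · intro h; exact absurd (Finset.mem_filter.2 ⟨Finset.mem_univ x, hx⟩) h
    · rw [if_neg hx]
      refine Finset.sum_eq_zero fun y hy => ?_
      have hy' : y i = 0 := (Finset.mem_filter.1 hy).2
      have : ((y, i) : Edge d L) ≠ (x, i) := by
        intro h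
        have hyx : y = x := congrArg Prod.fst h
        exact hx (by rw [← hyx]; exact hy')
      simp [this]
  · rw [if_neg (fun h => hm h.1)]
    refine Finset.sum_eq_zero fun y _ => ?_
    have : ((y, m) : Edge d L) ≠ (x, i) := fun h => hm (congrArg Prod.snd h)
    simp [this]

/-- **Every boundary vector has zero winding**: the two direction-`i` links `(x, i)`, `(x + e_j, i)` of the
plaquette `(x; i, j)` have the same `i`-th coordinate, and so do its two direction-`j` links (arithmetic in
`ℤ/2`). [ours] -/
theorem winding_boundaryVec (p : Plaquette d L) (m : Fin d) :
    ∑ y ∈ (Finset.univ.filter fun y : Site d L => y m = 0),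
        (Pi.single (p.1, p.2.1.1) 1 + Pi.single (p.1.shift p.2.1.1, p.2.1.2) 1 +
          Pi.single (p.1.shift p.2.1.2, p.2.1.1) 1 + Pi.single (p.1, p.2.1.2) 1 : Edge d L → ZMod 2) (y, m) =
      0 := by
  classical
  obtain ⟨x, ⟨⟨i, j⟩, hij⟩⟩ := p
  have hij' : i ≠ j := ne_of_lt hij
  simp only [Pi.add_apply, Finset.sum_add_distrib, winding_single]
  have h1 : (x.shift i) j = x j := by
    simp [Site.shift, Pi.single_eq_of_ne hij'.symm]
  have h2 : (x.shift j) i = x i := by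
    simp [Site.shift, Pi.single_eq_of_ne hij']
  rw [h1, h2]
  have key : ∀ a b : ZMod 2, a + b + a + b = 0 := by decide
  exact key _ _

/-! ## §2 The straight lines: cycles with unit winding -/

/-- **The straight line `z_n = Σ_{c ∈ ℤ/L} 𝟙_{(c·e_n, n)}` is a cycle**: its vertex parity vanishes (the
line is invariant under the shift by `e_n`, so every endpoint indicator appears twice). [ours] -/
theorem vertexParity_line (n : Fin d) :
    ((vertexParity_isLinear (d := d) (L := L)).mk')
        (∑ c : ZMod L, (Pi.single ((Pi.single n c : Site d L), n) 1 : Edge d L → ZMod 2)) = 0 := by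
  classical
  rw [map_sum]
  simp only [IsLinearMap.mk'_apply, vertexParity_single]
  have hshift : ∀ c : ZMod L, Site.shift (Pi.single n c : Site d L) n = Pi.single n (c + 1) := by
    intro c; simp only [Site.shift, ← Pi.single_add]
  simp only [hshift, Finset.sum_add_distrib]
  have hre : ∑ c : ZMod L, (Pi.single (Pi.single n (c + 1) : Site d L) 1 : Site d L → ZMod 2) =
      ∑ c : ZMod L, (Pi.single (Pi.single n c : Site d L) 1 : Site d L → ZMod 2) :=
    Fintype.sum_equiv (Equiv.addRight 1) _ _ (fun c => rfl)
  rw [hre]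
  ext y
  simp only [Pi.add_apply, Pi.zero_apply]
  have key : ∀ a : ZMod 2, a + a = 0 := by decide
  exact key _

/-- **The straight line `z_n` has winding vector `𝟙_n`**: it crosses the hyperplane `{x_n = 0}` exactly once
and has no links in the other directions. [ours] -/
theorem winding_line (n : Fin d) :
    ((winding_isLinear (d := d) (L := L)).mk')
        (∑ c : ZMod L, (Pi.single ((Pi.single n c : Site d L), n) 1 : Edge d L → ZMod 2)) =
      Pi.single n 1 := by
  classical
  rw [map_sum]
  ext m
  simp only [IsLinearMap.mk'_apply, Finset.sum_apply, winding_single, Pi.single_eq_same]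
  by_cases hm : m = n
  · subst hm
    simp [Finset.sum_ite_eq']
  · simp [hm]

/-! ## §3 Rank–nullity with the cycles: `#B + #sites + d ≤ #links + 1` -/

/-- **THE HOMOLOGY BOUND.**  `L ≥ 2`; `B` ranked (`t p` a link of `p`, `rank p < rank p'` whenever `t p` lies
on another `p' ∈ B`).  Then `#B + #sites + d ≤ #links + 1`: the boundary vectors of `B` are `#B` independent
vectors in the kernel of `ψ = (vertex parity, winding)`, and the range of `ψ` contains the `#sites − 1 + d`
independent vectors `ψ(path from 0 to y) = (𝟙_0 + 𝟙_y, ·)` (`y ≠ 0`) and `ψ(z_n) = (0, 𝟙_n)`. [ours] -/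
theorem card_add_card_site_add_le_card_edge_add_one_of_ranked (hL : 2 ≤ L) (B : Finset (Plaquette d L))
    (t : Plaquette d L → Edge d L)
    (ht : ∀ p ∈ B, t p ∈ ({(p.1, p.2.1.1), (p.1.shift p.2.1.1, p.2.1.2),
        (p.1.shift p.2.1.2, p.2.1.1), (p.1, p.2.1.2)} : Finset (Edge d L)))
    (rank : Plaquette d L → ℕ)
    (hrank : ∀ p ∈ B, ∀ p' ∈ B, p ≠ p' → t p ∈ ({(p'.1, p'.2.1.1), (p'.1.shift p'.2.1.1, p'.2.1.2),
        (p'.1.shift p'.2.1.2, p'.2.1.1), (p'.1, p'.2.1.2)} : Finset (Edge d L)) → rank p < rank p') :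
    B.card + Fintype.card (Site d L) + d ≤ Fintype.card (Edge d L) + 1 := by
  classical
  set V : (Edge d L → ZMod 2) →ₗ[ZMod 2] (Site d L → ZMod 2) :=
    (vertexParity_isLinear (d := d) (L := L)).mk' with hV
  set W : (Edge d L → ZMod 2) →ₗ[ZMod 2] (Fin d → ZMod 2) :=
    (winding_isLinear (d := d) (L := L)).mk' with hW
  set ψ : (Edge d L → ZMod 2) →ₗ[ZMod 2] (Site d L → ZMod 2) × (Fin d → ZMod 2) := V.prod W with hψ
  have hψapply : ∀ f, ψ f = (V f, W f) := fun f => rfl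
  -- (a) the boundary vectors of `B` are independent in `ker ψ`
  have hker : ∀ p : B,
      (Pi.single ((p : Plaquette d L).1, (p : Plaquette d L).2.1.1) 1 +
        Pi.single ((p : Plaquette d L).1.shift (p : Plaquette d L).2.1.1, (p : Plaquette d L).2.1.2) 1 +
        Pi.single ((p : Plaquette d L).1.shift (p : Plaquette d L).2.1.2, (p : Plaquette d L).2.1.1) 1 +
        Pi.single ((p : Plaquette d L).1, (p : Plaquette d L).2.1.2) 1 : Edge d L → ZMod 2) ∈
        LinearMap.ker ψ := by
    intro p
    rw [LinearMap.mem_ker, hψapply, Prod.mk_eq_zero]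
    refine ⟨?_, ?_⟩
    · rw [hV, IsLinearMap.mk'_apply]
      exact vertexParity_boundaryVec (p : Plaquette d L)
    · rw [hW, IsLinearMap.mk'_apply]
      exact funext fun m => winding_boundaryVec _ m
  have hliK : LinearIndependent (ZMod 2) (fun p : B => (⟨_, hker p⟩ : LinearMap.ker ψ)) := by
    apply LinearIndependent.of_comp (LinearMap.ker ψ).subtype
    exact linearIndependent_boundaryVec_of_ranked hL B t ht rank hrank
  have h1 : Fintype.card B ≤ Module.finrank (ZMod 2) (LinearMap.ker ψ) := hliK.fintype_card_le_finrank
  -- (b) `#sites − 1 + d` independent vectors in `range ψ`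
  have hpath : ∀ y : Site d L, ∃ f : Edge d L → ZMod 2,
      V f = (Pi.single 0 1 + Pi.single y 1 : Site d L → ZMod 2) := by
    intro y
    obtain ⟨f, hf⟩ := (LinearMap.mem_range).1
      (single_zero_add_single_mem_range_vertexParity (d := d) (L := L) y)
    exact ⟨f, hf⟩
  choose path hpath using hpath
  have hVline : ∀ n : Fin d,
      V (∑ c : ZMod L, (Pi.single ((Pi.single n c : Site d L), n) 1 : Edge d L → ZMod 2)) = 0 :=
    fun n => vertexParity_line n
  have hWline : ∀ n : Fin d,
      W (∑ c : ZMod L, (Pi.single ((Pi.single n c : Site d L), n) 1 : Edge d L → ZMod 2)) =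
        Pi.single n 1 :=
    fun n => winding_line n
  set v : {y : Site d L // y ≠ 0} ⊕ Fin d → (Site d L → ZMod 2) × (Fin d → ZMod 2) :=
    Sum.elim (fun y : {y : Site d L // y ≠ 0} => ψ (path (y : Site d L)))
      (fun n : Fin d => ψ (∑ c : ZMod L, (Pi.single ((Pi.single n c : Site d L), n) 1 : Edge d L → ZMod 2)))
    with hv
  have hvmem : ∀ s, v s ∈ LinearMap.range ψ := by
    rintro (y | n)
    · rw [hv, Sum.elim_inl]; exact LinearMap.mem_range_self ψ _
    · rw [hv, Sum.elim_inr]; exact LinearMap.mem_range_self ψ _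
  have hvl : ∀ y : {y : Site d L // y ≠ 0},
      v (Sum.inl y) = ((Pi.single 0 1 + Pi.single (y : Site d L) 1 : Site d L → ZMod 2), W (path y)) := by
    intro y
    rw [hv, Sum.elim_inl, hψapply, hpath]
  have hvr : ∀ n : Fin d, v (Sum.inr n) = ((0 : Site d L → ZMod 2), (Pi.single n 1 : Fin d → ZMod 2)) := by
    intro n
    rw [hv, Sum.elim_inr, hψapply, hVline, hWline]
  have hli : LinearIndependent (ZMod 2) (fun s => (⟨v s, hvmem s⟩ : LinearMap.range ψ)) := by
    apply LinearIndependent.of_comp (LinearMap.range ψ).subtype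
    rw [Fintype.linearIndependent_iff]
    intro g hg
    simp only [Function.comp_apply, Submodule.coe_subtype, Fintype.sum_sum_type, hvl, hvr] at hg
    -- first components: the coefficients of the paths vanish
    have hfst := congrArg Prod.fst hg
    simp only [Prod.fst_add, Prod.fst_sum, Prod.smul_fst, smul_zero, Finset.sum_const_zero, add_zero,
      Prod.fst_zero] at hfst
    have hgl : ∀ y : {y : Site d L // y ≠ 0}, g (Sum.inl y) = 0 := by
      intro y
      have heval := congrArg (fun f : Site d L → ZMod 2 => f (y : Site d L)) hfst
      simp only [Finset.sum_apply, Pi.smul_apply, Pi.add_apply, smul_eq_mul, Pi.zero_apply] at heval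
      rw [Finset.sum_eq_single y] at heval
      · have hy0 : (Pi.single (0 : Site d L) (1 : ZMod 2) : Site d L → ZMod 2) (y : Site d L) = 0 := by
          simp [y.2]
        rw [hy0, zero_add] at heval
        simpa using heval
      · intro y' _ hy'
        have e1 : (Pi.single (0 : Site d L) (1 : ZMod 2) : Site d L → ZMod 2) (y : Site d L) = 0 := by
          simp [y.2]
        have e2 : (Pi.single (y' : Site d L) (1 : ZMod 2) : Site d L → ZMod 2) (y : Site d L) = 0 := by
          have : (y : Site d L) ≠ (y' : Site d L) := fun h => hy' (Subtype.ext h).symm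
          simp [this]
        rw [e1, e2, add_zero, mul_zero]
      · intro h; exact absurd (Finset.mem_univ y) h
    -- second components: the coefficients of the lines vanish
    have hsnd := congrArg Prod.snd hg
    simp only [Prod.snd_sum, Prod.smul_snd, hgl, zero_smul, Finset.sum_const_zero, zero_add,
      Prod.snd_zero] at hsnd
    have hgr : ∀ n : Fin d, g (Sum.inr n) = 0 := by
      intro n
      have heval := congrArg (fun f : Fin d → ZMod 2 => f n) hsnd
      simp only [Finset.sum_apply, Pi.smul_apply, smul_eq_mul, Pi.zero_apply] at heval
      rw [Finset.sum_eq_single n] at heval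
      · simpa using heval
      · intro n' _ hn'
        have : n ≠ n' := fun h => hn' h.symm
        simp [this]
      · intro h; exact absurd (Finset.mem_univ n) h
    rintro (y | n)
    · exact hgl y
    · exact hgr n
  have h2 : Fintype.card ({y : Site d L // y ≠ 0} ⊕ Fin d) ≤
      Module.finrank (ZMod 2) (LinearMap.range ψ) := hli.fintype_card_le_finrank
  have hcard : Fintype.card ({y : Site d L // y ≠ 0} ⊕ Fin d) = Fintype.card (Site d L) - 1 + d := by
    rw [Fintype.card_sum, Fintype.card_subtype_compl, Fintype.card_subtype_eq, Fintype.card_fin]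
  -- (c) rank–nullity
  have h3 := LinearMap.finrank_range_add_finrank_ker ψ
  have h4 : Module.finrank (ZMod 2) (Edge d L → ZMod 2) = Fintype.card (Edge d L) :=
    Module.finrank_fintype_fun_eq_card _
  have hpos : 1 ≤ Fintype.card (Site d L) := Fintype.card_pos
  rw [Fintype.card_coe] at h1
  omega

/-- **Consequence: `#plaquettes + #sites + d ≤ k + #links + 1`** (`k = #Bᶜ`) for every ranked structure —
`k ≥ (d−1)(d−2)/2·L^d + (d−1)`, the parity bound raised by the `d` one-cycles of the torus. [ours] -/
theorem card_plaquette_add_card_site_add_le_of_ranked (hL : 2 ≤ L) (B : Finset (Plaquette d L))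
    (t : Plaquette d L → Edge d L)
    (ht : ∀ p ∈ B, t p ∈ ({(p.1, p.2.1.1), (p.1.shift p.2.1.1, p.2.1.2),
        (p.1.shift p.2.1.2, p.2.1.1), (p.1, p.2.1.2)} : Finset (Edge d L)))
    (rank : Plaquette d L → ℕ)
    (hrank : ∀ p ∈ B, ∀ p' ∈ B, p ≠ p' → t p ∈ ({(p'.1, p'.2.1.1), (p'.1.shift p'.2.1.1, p'.2.1.2),
        (p'.1.shift p'.2.1.2, p'.2.1.1), (p'.1, p'.2.1.2)} : Finset (Edge d L)) → rank p < rank p') :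
    Fintype.card (Plaquette d L) + Fintype.card (Site d L) + d ≤
      (Finset.univ \ B).card + Fintype.card (Edge d L) + 1 := by
  have h := card_add_card_site_add_le_card_edge_add_one_of_ranked hL B t ht rank hrank
  have hc : (Finset.univ \ B).card = Fintype.card (Plaquette d L) - B.card := Finset.card_univ_sdiff B
  have hB : B.card ≤ Fintype.card (Plaquette d L) := Finset.card_le_univ B
  omega

/-- **Closed form: `(d−1)(d−2)·L^d + 2(d−1) ≤ 2k`** for every ranked structure of `(ℤ/L)^d` (`L ≥ 2`; natural
subtraction, vacuous content for `d ≤ 1`) — against the layers' `2k = (d−1)(d−2)·L^d + 2(d−1)·L^{d−1}`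
(`TorusRankedLayers`). [ours] -/
theorem homologyBound_closed_form (hL : 2 ≤ L) (B : Finset (Plaquette d L))
    (t : Plaquette d L → Edge d L)
    (ht : ∀ p ∈ B, t p ∈ ({(p.1, p.2.1.1), (p.1.shift p.2.1.1, p.2.1.2),
        (p.1.shift p.2.1.2, p.2.1.1), (p.1, p.2.1.2)} : Finset (Edge d L)))
    (rank : Plaquette d L → ℕ)
    (hrank : ∀ p ∈ B, ∀ p' ∈ B, p ≠ p' → t p ∈ ({(p'.1, p'.2.1.1), (p'.1.shift p'.2.1.1, p'.2.1.2),
        (p'.1.shift p'.2.1.2, p'.2.1.1), (p'.1, p'.2.1.2)} : Finset (Edge d L)) → rank p < rank p') :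
    (d - 1) * (d - 2) * L ^ d + 2 * (d - 1) ≤ 2 * (Finset.univ \ B).card := by
  have h := card_plaquette_add_card_site_add_le_of_ranked hL B t ht rank hrank
  have hP := two_mul_card_plaquette d L
  rw [Summit.Ventures.LatticeQCDFlow.Runbook.card_site] at h hP
  rw [Summit.Ventures.LatticeQCDFlow.Runbook.card_edge] at h
  rcases Nat.lt_or_ge d 2 with hd | hd
  · interval_cases d <;> simp
  · obtain ⟨n, rfl⟩ : ∃ n, d = n + 2 := ⟨d - 2, by omega⟩
    rw [show n + 2 - 1 = n + 1 from rfl] at hP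
    rw [show n + 2 - 1 = n + 1 from rfl, show n + 2 - 2 = n from rfl]
    have hP' : 2 * Fintype.card (Plaquette (n + 2) L) = L ^ (n + 2) * (n + 2) * (n + 1) := by
      rw [hP]; ring
    nlinarith [hP', h]

/-! ## §4 Instances: three dimensions exactly, four dimensions, two dimensions -/

/-- **`d = 3`: `L³ + 2 ≤ k`** for every ranked structure of `(ℤ/L)³` (`L ≥ 2`) — three plaquettes above the
parity bound `L³ − 1` of `TorusRankedParityBound`. [ours] -/
theorem pow_three_add_two_le_card_compl_of_ranked (hL : 2 ≤ L) (B : Finset (Plaquette 3 L))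
    (t : Plaquette 3 L → Edge 3 L)
    (ht : ∀ p ∈ B, t p ∈ ({(p.1, p.2.1.1), (p.1.shift p.2.1.1, p.2.1.2),
        (p.1.shift p.2.1.2, p.2.1.1), (p.1, p.2.1.2)} : Finset (Edge 3 L)))
    (rank : Plaquette 3 L → ℕ)
    (hrank : ∀ p ∈ B, ∀ p' ∈ B, p ≠ p' → t p ∈ ({(p'.1, p'.2.1.1), (p'.1.shift p'.2.1.1, p'.2.1.2),
        (p'.1.shift p'.2.1.2, p'.2.1.1), (p'.1, p'.2.1.2)} : Finset (Edge 3 L)) → rank p < rank p') :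
    L ^ 3 + 2 ≤ (Finset.univ \ B).card := by
  have h := card_plaquette_add_card_site_add_le_of_ranked hL B t ht rank hrank
  have hP := two_mul_card_plaquette 3 L
  rw [Summit.Ventures.LatticeQCDFlow.Runbook.card_site] at h hP
  rw [Summit.Ventures.LatticeQCDFlow.Runbook.card_edge] at h
  omega

/-- **`k_min(3) = L³ + 2` EXACTLY**: every ranked structure of `(ℤ/L)³` (`L ≥ 2`) leaves `k ≥ L³ + 2` of the
`3L³` plaquettes outside (the homology bound), and the comb-tree structure of `TorusRankedThreeDimCount`
(injective top links) leaves exactly `L³ + 2`. [ours] -/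
theorem threeDim_gap_eq (hL : 2 ≤ L) :
    (∀ (B : Finset (Plaquette 3 L)) (t : Plaquette 3 L → Edge 3 L) (rank : Plaquette 3 L → ℕ),
      (∀ p ∈ B, t p ∈ ({(p.1, p.2.1.1), (p.1.shift p.2.1.1, p.2.1.2),
        (p.1.shift p.2.1.2, p.2.1.1), (p.1, p.2.1.2)} : Finset (Edge 3 L))) →
      (∀ p ∈ B, ∀ p' ∈ B, p ≠ p' → t p ∈ ({(p'.1, p'.2.1.1), (p'.1.shift p'.2.1.1, p'.2.1.2),
        (p'.1.shift p'.2.1.2, p'.2.1.1), (p'.1, p'.2.1.2)} : Finset (Edge 3 L)) → rank p < rank p') →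
      L ^ 3 + 2 ≤ (Finset.univ \ B).card) ∧
    ∃ (B : Finset (Plaquette 3 L)) (t : Plaquette 3 L → Edge 3 L) (rank : Plaquette 3 L → ℕ),
      Set.InjOn t B ∧
      (∀ p ∈ B, t p ∈ ({(p.1, p.2.1.1), (p.1.shift p.2.1.1, p.2.1.2),
        (p.1.shift p.2.1.2, p.2.1.1), (p.1, p.2.1.2)} : Finset (Edge 3 L))) ∧
      (∀ p ∈ B, ∀ p' ∈ B, p ≠ p' → t p ∈ ({(p'.1, p'.2.1.1), (p'.1.shift p'.2.1.1, p'.2.1.2),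
        (p'.1.shift p'.2.1.2, p'.2.1.1), (p'.1, p'.2.1.2)} : Finset (Edge 3 L)) → rank p < rank p') ∧
      (Finset.univ \ B).card = L ^ 3 + 2 :=
  ⟨fun B t rank ht hrank => pow_three_add_two_le_card_compl_of_ranked hL B t ht rank hrank,
    exists_ranked_three_card_compl hL⟩

/-- **The minimum over ranked structures of `(ℤ/L)³` of the number of plaquettes left outside is `L³ + 2`**
(`L ≥ 2`), phrased on the set of attained values. [ours] -/
theorem isLeast_card_compl_ranked_three (hL : 2 ≤ L) :
    IsLeast {k : ℕ | ∃ (B : Finset (Plaquette 3 L)) (t : Plaquette 3 L → Edge 3 L) (rank : Plaquette 3 L → ℕ),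
      (∀ p ∈ B, t p ∈ ({(p.1, p.2.1.1), (p.1.shift p.2.1.1, p.2.1.2),
        (p.1.shift p.2.1.2, p.2.1.1), (p.1, p.2.1.2)} : Finset (Edge 3 L))) ∧
      (∀ p ∈ B, ∀ p' ∈ B, p ≠ p' → t p ∈ ({(p'.1, p'.2.1.1), (p'.1.shift p'.2.1.1, p'.2.1.2),
        (p'.1.shift p'.2.1.2, p'.2.1.1), (p'.1, p'.2.1.2)} : Finset (Edge 3 L)) → rank p < rank p') ∧
      (Finset.univ \ B).card = k} (L ^ 3 + 2) := by
  obtain ⟨hlow, B, t, rank, -, ht, hrank, hk⟩ := threeDim_gap_eq hL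
  refine ⟨⟨B, t, rank, ht, hrank, hk⟩, ?_⟩
  rintro k ⟨B', t', rank', ht', hrank', rfl⟩
  exact hlow B' t' rank' ht' hrank'

/-- **`d = 4`: `3L⁴ + 3 ≤ k`** for every ranked structure of `(ℤ/L)⁴` (`L ≥ 2`): of the `6L⁴` plaquettes at
least `3L⁴ + 3` stay outside every exact one-plaquette heat-bath autoregression (the layers leave
`3L⁴ + 3L³`). [ours] -/
theorem three_mul_pow_four_add_three_le_card_compl_of_ranked (hL : 2 ≤ L) (B : Finset (Plaquette 4 L))
    (t : Plaquette 4 L → Edge 4 L)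
    (ht : ∀ p ∈ B, t p ∈ ({(p.1, p.2.1.1), (p.1.shift p.2.1.1, p.2.1.2),
        (p.1.shift p.2.1.2, p.2.1.1), (p.1, p.2.1.2)} : Finset (Edge 4 L)))
    (rank : Plaquette 4 L → ℕ)
    (hrank : ∀ p ∈ B, ∀ p' ∈ B, p ≠ p' → t p ∈ ({(p'.1, p'.2.1.1), (p'.1.shift p'.2.1.1, p'.2.1.2),
        (p'.1.shift p'.2.1.2, p'.2.1.1), (p'.1, p'.2.1.2)} : Finset (Edge 4 L)) → rank p < rank p') :
    3 * L ^ 4 + 3 ≤ (Finset.univ \ B).card := by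
  have h := card_plaquette_add_card_site_add_le_of_ranked hL B t ht rank hrank
  rw [Summit.Ventures.LatticeQCDFlow.Runbook.card_plaquette_four,
    Summit.Ventures.LatticeQCDFlow.Runbook.card_site, Summit.Ventures.LatticeQCDFlow.Runbook.card_edge] at h
  omega

/-- **`d = 2`: `1 ≤ k`** for every ranked structure of `(ℤ/L)²` (`L ≥ 2`) — the homology bound is sharp in two
dimensions as well (the comb of `Scaling/AutoregressiveGaugeHeatBathComb` leaves exactly one plaquette).
[ours] -/
theorem one_le_card_compl_of_ranked_two (hL : 2 ≤ L) (B : Finset (Plaquette 2 L))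
    (t : Plaquette 2 L → Edge 2 L)
    (ht : ∀ p ∈ B, t p ∈ ({(p.1, p.2.1.1), (p.1.shift p.2.1.1, p.2.1.2),
        (p.1.shift p.2.1.2, p.2.1.1), (p.1, p.2.1.2)} : Finset (Edge 2 L)))
    (rank : Plaquette 2 L → ℕ)
    (hrank : ∀ p ∈ B, ∀ p' ∈ B, p ≠ p' → t p ∈ ({(p'.1, p'.2.1.1), (p'.1.shift p'.2.1.1, p'.2.1.2),
        (p'.1.shift p'.2.1.2, p'.2.1.1), (p'.1, p'.2.1.2)} : Finset (Edge 2 L)) → rank p < rank p') :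
    1 ≤ (Finset.univ \ B).card := by
  have h := card_plaquette_add_card_site_add_le_of_ranked hL B t ht rank hrank
  have hP := two_mul_card_plaquette 2 L
  rw [Summit.Ventures.LatticeQCDFlow.Runbook.card_site] at h hP
  rw [Summit.Ventures.LatticeQCDFlow.Runbook.card_edge] at h
  omega

end Summit.Ventures.LatticeQCDFlow.Theory2.Autoregressive
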